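import Literature.NumberTheory.Transcendental.KZMonomialCompression
import Literature.NumberTheory.Transcendental.KZGroundingRelations
import HarnessLib

/-!
# Viu-Sos' semi-canonical reduction: sign splitting and the bounded-volumes decomposition

Proof file of `KZVolumeConjecture.lean` around the named fact `KZ.semiCanonicalReduction`
[J. Viu-Sos, *A semi-canonical reduction for periods of Kontsevich–Zagier*, Int. J. Number Theory
17 (2021) 147–174 (arXiv:1509.01097), **Thm. 1.1**]. The discharge under the canonical name
`KZ.semiCanonicalReduction_holds` (and `KZ.kzPeriodConjecture'_iff_volumeConjectureCompact_holds`)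
lives in `KZVolumeConjectureProofs.lean`, which landed the same resolution-free assembly at the
same time as the first version of this file; to keep the tree free of duplicate declarations this
file now records only its own packaging of that route, theorems only:

1. **sign and graph** (rules (1), (3)): `exists_posPart`, `exists_sub_add_mem_relations_sign`
   (`[σ, f] ≡ [σ, f⁺] − [σ, f⁻]`), and `[σ, f^±] ≡ [E±, 1]` with `E± ⊆ ℝ^{d+1}` the regions under
   the graphs (`KZ.exists_underGraph`);
2. **grounding** (rules (1)–(3)): `[E, 1] ≡ [D, 1]` for a coordinatewise down-set `D` of the open
   positive orthant (`KZ.exists_downset_sub_mem_relations`, `KZGroundingRelations.lean`);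
3. **monomial compression** (rule (2)): `[D, 1] ≡ [B, 1]` with `B` BOUNDED
   (`KZ.exists_isBounded_of_downset`, `KZMonomialCompression.lean`);
   together: `exists_boundedVolume_sub_mem_relations` (a non-negative integrand is one bounded
   volume one dimension up), whence every representation is `≡ [A] − [B]` with `A`, `B` bounded
   volumes one dimension up (the upstream `KZ.exists_sub_isBounded`);
4. **packing** (Viu-Sos §4, `KZ.exists_isCompact_of_sub_of_sub_mem_relations`):
   `semiCanonicalReduction_of_boundedVolumes : semiCanonicalReduction`.

Viu-Sos' printed proof instead compactifies by projective charts (§2.2) and separates the poles by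
Hironaka's embedded resolution (§2.3); the statement proved is the printed one with `m = d + 1`.
Theorems only: no definition, no named fact.

## References

* J. Viu-Sos, *A semi-canonical reduction for periods of Kontsevich–Zagier*, Int. J. Number
  Theory 17 (2021) 147–174, arXiv:1509.01097: Thm. 1.1, Cor. 2.3, §4. [ViuSos2021]
* M. Kontsevich, D. Zagier, *Periods* (2001), §1.1 ("area under the graph"), §1.2 (rules (1)–(3)).
  [KontsevichZagier2001]
-/

noncomputable section

open MeasureTheory Set

namespace Literature.NumberTheory.Transcendental

namespace KZ

variable {n : ℕ}

/-- **The positive part of a representation exists**: `(σ, max (f, 0))` is again an integral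
representation (`max (f, 0) = (f + |f|)/2` is `ℚ`-semialgebraic, and integrable).
[folklore] -/
theorem exists_posPart (r : IntegralRep n) :
    ∃ p : IntegralRep n, p.domain = r.domain ∧ (p.integrand = fun x => max (r.integrand x) 0) := by
  have h : IsSemialgebraicFunOn ℚ r.domain (fun _ => (1 / 2 : ℝ)) :=
    (isSemialgebraicFunOn_aeval r.isSemialgebraic_domain (MvPolynomial.C (1 / 2 : ℚ))).congr
      fun x _ => by simp
  have h2 := IsSemialgebraicFunOn.mul_holds h
    (IsSemialgebraicFunOn.add_holds r.isSemialgebraicFunOn_integrand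
      r.isSemialgebraicFunOn_integrand.abs)
  have hsa : IsSemialgebraicFunOn ℚ r.domain fun x => max (r.integrand x) 0 := by
    refine h2.congr fun x _ => ?_
    simp only [Pi.mul_apply, Pi.add_apply]
    rcases le_total 0 (r.integrand x) with h | h
    · rw [max_eq_left h, abs_of_nonneg h]; ring
    · rw [max_eq_right h, abs_of_nonpos h]; ring
  exact ⟨⟨r.domain, fun x => max (r.integrand x) 0, r.isSemialgebraic_domain, hsa,
    r.integrableOn.pos_part⟩, rfl, rfl⟩

/-- **Splitting by sign** [Viu-Sos 2021, proof of Cor. 2.3: `S = S⁺ ∪ S⁻`]: there are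
representations `p = (σ, max (f, 0))`, `q = (σ, max (−f, 0))` with non-negative integrands and
`[r] − [p] + [q] ∈ relations` (integrand additivity, rule (1)). [cite: ViuSos2021, Cor. 2.3] -/
theorem exists_sub_add_mem_relations_sign (r : IntegralRep n) :
    ∃ p q : IntegralRep n, (∀ x ∈ p.domain, 0 ≤ p.integrand x) ∧ (∀ x ∈ q.domain, 0 ≤ q.integrand x) ∧
      of r - of p + of q ∈ relations := by
  obtain ⟨p, hpd, hpi⟩ := exists_posPart r
  obtain ⟨q, hqd, hqi⟩ := exists_posPart r.neg
  refine ⟨p, q, fun x _ => by rw [hpi]; exact le_max_right _ _,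
    fun x _ => by rw [hqi]; exact le_max_right _ _, ?_⟩
  have h1 : of r - of p - of q.neg ∈ relations :=
    integrandAddRel_subset_relations ⟨n, r, p, q.neg, hpd, by simpa using hqd, fun x _ => by
      simp only [Pi.add_apply, hpi, IntegralRep.integrand_neg, Pi.neg_apply, hqi]
      rcases le_total 0 (r.integrand x) with h | h
      · rw [max_eq_left h, max_eq_right (by linarith)]; ring
      · rw [max_eq_right h, max_eq_left (by linarith)]; ring, rfl⟩
  have h2 : of q + of q.neg ∈ relations := of_add_of_mem_relations_of_eqOn_neg rfl fun x _ => rfl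
  have : of r - of p + of q = (of r - of p - of q.neg) + (of q + of q.neg) := by abel
  rw [this]
  exact relations.add_mem h1 h2

/-- **A non-negative integrand is a bounded volume one dimension up, modulo moves**: region under
the graph (rule (3), `exists_underGraph`), grounding (`exists_downset_sub_mem_relations`), monomial
compression (`exists_isBounded_of_downset`). [folklore] -/
theorem exists_boundedVolume_sub_mem_relations (r : IntegralRep n) (h0 : ∀ x ∈ r.domain, 0 ≤ r.integrand x) :
    ∃ B : IntegralRep (n + 1), Bornology.IsBounded B.domain ∧ (∀ z ∈ B.domain, B.integrand z = 1) ∧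
      of r - of B ∈ relations := by
  obtain ⟨E, -, hEi, hEr⟩ := exists_underGraph r h0
  have hE1 : ∀ z ∈ E.domain, E.integrand z = 1 := fun z _ => by rw [hEi]
  obtain ⟨D, hpos, hdown, hD1, hED⟩ := exists_downset_sub_mem_relations E hE1
  obtain ⟨B, hBb, hB1, hDB⟩ := exists_isBounded_of_downset D hpos hdown hD1
  refine ⟨B, hBb, hB1, ?_⟩
  have : of r - of B = -(of E - of r) + (of E - of D) + (of D - of B) := by abel
  rw [this]
  exact relations.add_mem (relations.add_mem (relations.neg_mem
    (newtonLeibnizRel_subset_relations hEr)) hED) hDB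

/-- **Viu-Sos' semi-canonical reduction from the bounded-volumes decomposition** [Viu-Sos 2021,
Thm. 1.1]: the named fact `semiCanonicalReduction`, re-derived from the sign splitting,
`exists_boundedVolume_sub_mem_relations` and the packing of Viu-Sos §4
(`exists_isCompact_of_sub_of_sub_mem_relations`), according to the sign of `p` — by soundness
`vol A − vol B = p`. The tree's discharge under the canonical name `semiCanonicalReduction_holds`
is the (simultaneously landed, equivalent) one of `KZVolumeConjectureProofs.lean`; this theorem is
kept as the assembly of the present file's route and is definitionally the same statement.
[cite: ViuSos2021, Thm. 1.1] -/
theorem semiCanonicalReduction_of_boundedVolumes : semiCanonicalReduction := by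
  intro d r _ hv
  -- `[r] ≡ [A] − [B]` with `A`, `B` bounded volumes in dimension `d + 1`
  obtain ⟨p, q, hp, hq, hpq⟩ := exists_sub_add_mem_relations_sign r
  obtain ⟨A, hAb, hA1, hA⟩ := exists_boundedVolume_sub_mem_relations p hp
  obtain ⟨B, hBb, hB1, hB⟩ := exists_boundedVolume_sub_mem_relations q hq
  have hrel : of r - (of A - of B) ∈ relations := by
    have : of r - (of A - of B) = (of r - of p + of q) + (of p - of A) - (of q - of B) := by abel
    rw [this]
    exact relations.sub_mem (relations.add_mem hpq hA) hB
  have hval : r.value = A.value - B.value := by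
    have h := relations_le_ker_eval_holds hrel
    rw [AddMonoidHom.mem_ker] at h
    simp only [map_sub, eval_of] at h
    linarith
  rcases lt_or_gt_of_ne hv with hneg | hpos
  · obtain ⟨K, hKc, hKi, hK1, hK⟩ :=
      exists_isCompact_of_sub_of_sub_mem_relations B A hBb hAb hB1 hA1 (by linarith)
    refine ⟨d + 1, K, Nat.succ_pos d, le_rfl, hKc, hKi, hK1,
      fun h => absurd h (not_lt.2 hneg.le), fun _ => ?_⟩
    have : of r + of K = (of r - (of A - of B)) - (of B - of A - of K) := by abel
    rw [this]
    exact relations.sub_mem hrel hK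
  · obtain ⟨K, hKc, hKi, hK1, hK⟩ :=
      exists_isCompact_of_sub_of_sub_mem_relations A B hAb hBb hA1 hB1 (by linarith)
    refine ⟨d + 1, K, Nat.succ_pos d, le_rfl, hKc, hKi, hK1, fun _ => ?_,
      fun h => absurd h (not_lt.2 hpos.le)⟩
    have : of r - of K = (of r - (of A - of B)) + (of A - of B - of K) := by abel
    rw [this]
    exact relations.add_mem hrel hK

end KZ

end Literature.NumberTheory.Transcendental
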